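import Mathlib
import HarnessLib
import HarnessLib.Audit
import Summits.Parity.Statement
import Literature.Barriers.Parity.SiegelZeroDichotomy
import Literature.NumberTheory.Sieve.HardyLittlewood

/-!
Route: ConvexityCrossing

DORMANT since 2026-09-04T15:41:53Z (reconciler: no traction for 5 d (last activity statement-checked at 2026-08-30T14:19:48Z); parked, not closed — `ledger route dormant route-Parity-ConvexityCrossing --off` to reactivate) — unstaffed, not closed; items shared with open routes are served there. `ledger route dormant <id> --off` reactivates.

# Route ConvexityCrossing — GHL ⟸ the record's Siegel/upper/uniform leaves ∧ the failure of the
Hardy–Littlewood convexity conjecture ∧ its lift to the fixed-pattern lower bound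

decomp-parity (D-0178/D-0179) lens-5 node «ConvexityCrossing» (gen 8, RESIDUAL mode, BLOCKER FIRST;
critic CLEARED HOME/STATUS.md l.386,
CRITIC-LEDGER row 75, as an AXIS REGISTRATION with precisions P1–P5; filing = lens-5 g9 per writer
l.387): an ALTERNATIVE DECOMPOSITION of the record
route route-Parity-SiegelSpectrumSplit beneath its fixed-pattern lower leaf FL = stmt-Parity-26863
on the CONVEXITY axis (Hardy–Littlewood's ρ(y) against
π(y)). It suffices to show X = Q ∧ FixedUpper ∧ UniformUpperGivenFixed ∧ ConvexityFails ∧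
ConvexityLift ∧ UniformLowerGivenFixed, where Q (25148),
FixedUpper (26852), UniformUpperGivenFixed (26853), UniformLowerGivenFixed (26864) are the record's
items VERBATIM (shared by signature), ConvexityFails :=
«the second Hardy–Littlewood (convexity) conjecture (A) ∀ x,y ≥ 2, π(x+y) ≤ π(x)+π(y) FAILS» (Σ₁:
some window of y consecutive integers beyond x holds more
primes than (0,y]; text = ¬(A) spelled over Nat.primeCounting, `Iff.rfl` with ¬
Literature.Barriers.Parity.SecondHardyLittlewoodConjecture) and ConvexityLift :=
ConvexityFails → FL (declared residual). Kernel HOME/decomp-parity-lens-5/g8/ConvexityCrossing.lean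
(rc 0, 0 sorry; critic probe rc 0): necessity FL ⟹
ConvexityFails hypothesis-free through the TREE certificate ρ*(20000) ≥ 2263 > 2262 = π(20000)
(landed GhostBoundaryCarvingTwoOfThree.weakDHL_of_fixedLower ∘
tree hensleyRichards_incompatibility), fixedLower_iff : FL ↔ ConvexityFails ∧ ConvexityLift, closes
with 6/6 binders by pure logic, kill path (A) ⟹ ¬FL,
¬GHL, ¬Parity typed. CLAIMED, NOT CERTIFIED today (P4): the add-ons ConvexityCrossingBH
(ConvexityFails a COMMON FACTOR of BH too, via tree
schinzelHypothesisH_of_batemanHornConjecture ∘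
SchinzelHypothesisH.not_secondHardyLittlewoodConjecture), ConvexityCrossingFloor (ρ(247) ≥ 2
hypothesis-free)
and ConvexityCrossingBarrier are farm-stale (rc 75) — their tags are claims until those files build.
Lean: `(∃ η₀ : ℝ, ∃ q₀ : ℕ, ∀ (q : ℕ) [NeZero q] (χ : DirichletCharacter ℂ q) (η : ℝ), q₀ ≤ q →
Literature.Barriers.Parity.IsSiegelZero χ η → η < η₀) ∧ (∀ (d t : ℕ), 1 ≤ d → 1 ≤ t → ∀ Ψ : Fin t →
Literature.NumberTheory.Sieve.AffLinForm d, Literature.NumberTheory.Sieve.IsNondegenerateSystem Ψ →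
∀ ε : ℝ, 0 < ε → ∃ N₀ : ℕ, ∀ N : ℕ, N₀ ≤ N → ∀ K : Set (Fin d → ℝ), Convex ℝ K → K ⊆
Literature.NumberTheory.Sieve.realBox d N → Literature.NumberTheory.Sieve.vonMangoldtSum Ψ K N -
Literature.NumberTheory.Sieve.archFactor Ψ K * Literature.NumberTheory.Sieve.singularProduct Ψ ≤ ε *
(N : ℝ) ^ d) ∧ ((∃ η₀ : ℝ, ∃ q₀ : ℕ, ∀ (q : ℕ) [NeZero q] (χ : DirichletCharacter ℂ q) (η : ℝ), q₀ ≤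
q → Literature.Barriers.Parity.IsSiegelZero χ η → η < η₀) → (∀ (d t : ℕ), 1 ≤ d → 1 ≤ t → ∀ Ψ : Fin
t → Literature.NumberTheory.Sieve.AffLinForm d, Literature.NumberTheory.Sieve.IsNondegenerateSystem
Ψ → ∀ ε : ℝ, 0 < ε → ∃ N₀ : ℕ, ∀ N : ℕ, N₀ ≤ N → ∀ K : Set (Fin d → ℝ), Convex ℝ K → K ⊆
Literature.NumberTheory.Sieve.realBox d N → Literature.NumberTheory.Sieve.vonMangoldtSum Ψ K N -
Literature.NumberTheory.Sieve.archFactor Ψ K * Literature.NumberTheory.Sieve.singularProduct Ψ ≤ ε *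
(N : ℝ) ^ d) → ∀ (d t L : ℕ), 1 ≤ d → 1 ≤ t → ∀ ε : ℝ, 0 < ε → ∃ N₀ : ℕ, ∀ N : ℕ, N₀ ≤ N → ∀ Ψ : Fin
t → Literature.NumberTheory.Sieve.AffLinForm d, Literature.NumberTheory.Sieve.IsNondegenerateSystem
Ψ → Literature.NumberTheory.Sieve.affLinSize Ψ N ≤ L → ∀ K : Set (Fin d → ℝ), Convex ℝ K → K ⊆
Literature.NumberTheory.Sieve.realBox d N → Literature.NumberTheory.Sieve.vonMangoldtSum Ψ K N -
Literature.NumberTheory.Sieve.archFactor Ψ K * Literature.NumberTheory.Sieve.singularProduct Ψ ≤ ε *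
(N : ℝ) ^ d) ∧ (¬ (∀ x y : ℕ, 2 ≤ x → 2 ≤ y → Nat.primeCounting (x + y) ≤ Nat.primeCounting x +
Nat.primeCounting y)) ∧ ((¬ (∀ x y : ℕ, 2 ≤ x → 2 ≤ y → Nat.primeCounting (x + y) ≤
Nat.primeCounting x + Nat.primeCounting y)) → (∀ (d t : ℕ), 1 ≤ d → 1 ≤ t → ∀ Ψ : Fin t →
Literature.NumberTheory.Sieve.AffLinForm d, Literature.NumberTheory.Sieve.IsNondegenerateSystem Ψ →
∀ ε : ℝ, 0 < ε → ∃ N₀ : ℕ, ∀ N : ℕ, N₀ ≤ N → ∀ K : Set (Fin d → ℝ), Convex ℝ K → K ⊆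
Literature.NumberTheory.Sieve.realBox d N → Literature.NumberTheory.Sieve.archFactor Ψ K *
Literature.NumberTheory.Sieve.singularProduct Ψ - Literature.NumberTheory.Sieve.vonMangoldtSum Ψ K N
≤ ε * (N : ℝ) ^ d)) ∧ ((∃ η₀ : ℝ, ∃ q₀ : ℕ, ∀ (q : ℕ) [NeZero q] (χ : DirichletCharacter ℂ q) (η :
ℝ), q₀ ≤ q → Literature.Barriers.Parity.IsSiegelZero χ η → η < η₀) → (∀ (d t : ℕ), 1 ≤ d → 1 ≤ t → ∀
Ψ : Fin t → Literature.NumberTheory.Sieve.AffLinForm d,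
Literature.NumberTheory.Sieve.IsNondegenerateSystem Ψ → ∀ ε : ℝ, 0 < ε → ∃ N₀ : ℕ, ∀ N : ℕ, N₀ ≤ N →
∀ K : Set (Fin d → ℝ), Convex ℝ K → K ⊆ Literature.NumberTheory.Sieve.realBox d N →
Literature.NumberTheory.Sieve.archFactor Ψ K * Literature.NumberTheory.Sieve.singularProduct Ψ -
Literature.NumberTheory.Sieve.vonMangoldtSum Ψ K N ≤ ε * (N : ℝ) ^ d) → ∀ (d t L : ℕ), 1 ≤ d → 1 ≤ t
→ ∀ ε : ℝ, 0 < ε → ∃ N₀ : ℕ, ∀ N : ℕ, N₀ ≤ N → ∀ Ψ : Fin t →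
Literature.NumberTheory.Sieve.AffLinForm d, Literature.NumberTheory.Sieve.IsNondegenerateSystem Ψ →
Literature.NumberTheory.Sieve.affLinSize Ψ N ≤ L → ∀ K : Set (Fin d → ℝ), Convex ℝ K → K ⊆
Literature.NumberTheory.Sieve.realBox d N → Literature.NumberTheory.Sieve.archFactor Ψ K *
Literature.NumberTheory.Sieve.singularProduct Ψ - Literature.NumberTheory.Sieve.vonMangoldtSum Ψ K N
≤ ε * (N : ℝ) ^ d)`

## Assembly
Pure logic plus |a − b| ≤ c ⟺ (a − b ≤ c ∧ b − a ≤ c): hUU hQ hFU is the uniform upper half, hUL hQ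
(hL hC) the uniform lower half (ConvexityLift
consumes ConvexityFails and yields FixedLower), and the two halves with N₀ := max give GHL (`closes`
in glue.lean, 6/6 binders consumed). Exactness in the
cell kernel: fixedLower_iff (FixedLower ↔ ConvexityFails ∧ ConvexityLift) and node_iff (GHL ↔ X
modulo the record's own necessity GHL ⟹ Q, Matomäki–Merikoski
2023 — the record carries the same caveat).

Rationale: WHY THIS LINE. Lens 5 «finite certified range + asymptotic regime + bridge» applied to the ONE place
where a finite certified computation is load-bearing for an asymptotic
consequence of Parity: the (y, m) square of Hardy–Littlewood's ρ-function (ρ(y) ≥ m ⟺ infinitely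
many windows of y consecutive integers with ≥ m primes,
HardyLittlewoodPN3 (5.611)). FINITE CERTIFIED RANGE: Richards' packing number ρ*(y) (Richards1974
Def. 1.7, decidable) bounds the prime side for every y and
the tree's `decide` certificate (le_rhoStar_twentyThousand, primeCounting_twentyThousand) puts the
convexity line m = π(y)+1 INSIDE the admissible region at
y = 20000; ASYMPTOTIC REGIME: Hensley–Richards Thm 4.1 (HensleyRichards1974: ρ*(y) − π(y) → +∞);
BRIDGE: the prime k-tuples conjecture DHL transports packing
counts to prime clusters monotonically in (y, m) (Richards Prop. 1.9). The credited piece is the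
WEAKEST statement on the far side of the convexity line — one
nonconvex prime constellation, somewhere — NECESSARY for FL, GHL and Parity by kernel theorems,
SIEGEL-INERT (no constant, no threshold, no literal), and
attackable by NO named input short of prime-tuple strength (nec_input = DHL[2263,2263]; the
GPY–Maynard–Polymath class is EMPTY at the crossing for every
level 0 < θ ≤ 1, kernel crossing_beyond_exp_ceiling over Polymath8b2014 Cor. 6.4) — hence filed as
an IDEA-NEEDED Σ₁-notch: credit ONLY in the ρ(y) − π(y)
currency and only for certified rungs, distance credit 0, NO prover time on either new item (P1).
Imported: the combinatorics of admissible tuples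
(Erdős–Rankin/CRT packing, Engelsma's exhaustive searches, arXiv:2605.19165) and the
Hensley–Richards incompatibility; versus prior routes and the negatives
index: no Parity route item, card or refuted statement uses the convexity / cluster-excess axis
(¬(A) occurs in the tree only as a consequence theorem and as
the catalogued barrier entry, whose NEGATION is the necessary piece); disjoint from the k-currency
of GhostBoundaryCarving (m = 2 edge), from ArtinGenericSplit,
ShiftedPrimeFactor (θ = 17/25) and ConstellationCubes, the other notches on FL.

RANKED CRUXES. #2 ConvexityFails (crux) — the second Hardy–Littlewood (convexity) conjecture (A)
«π(x+y) ≤ π(x) + π(y) for all integers x, y ≥ 2» (HardyLittlewoodPN3 §5.61 p. 54; Richards1974 (A)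
p. 421; CrandallPomerance1999 Conj. 1.2.3) FAILS: ∃ x, y ≥ 2 with π(x) + π(y) < π(x+y) (kernel
convexityFails_iff) — text `Iff.rfl` with ¬
Literature.Barriers.Parity.SecondHardyLittlewoodConjecture. NECESSARY ×3 hypothesis-free (kernel
convexityFails_of_fixedLower = landed GhostBoundaryCarvingTwoOfThree.weakDHL_of_fixedLower ∘ tree
hensleyRichards_incompatibility through the decide-certificate ρ*(20000) ≥ 2263 > π(20000) = 2262;
convexityFails_of_ghl; convexityFails_of_parity; nec_input DHL[2263,2263] = tree
not_secondHardyLittlewood_of_weakDHL) and STRICTLY WEAKER (one Σ₁ instance, no asymptotic, no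
constant, no pattern). TAGS (critic row 75): IDEA-NEEDED Σ₁-NOTCH, AXIS REGISTRATION, distance
credit 0; credit ONLY in the ρ(y) − π(y) currency and only for certified rungs (packing side: ρ*
tables, Engelsma–Holt (459, 3242) by decide = zero-summit-credit instruments; prime side: ClusterAt
y m records with m ≤ π(y), floor ρ(247) ≥ 2 CLAIMED (add-on farm-stale, P4), zero credit until m =
π(y)+1); NO PROVER TIME (P1) — hands only: Theorems/ConvexityCrossingNecessity.lean --supports this
item (kernel §2–§4 on the born decls, P3); re-dials (other y, m, lim-sup vs subadditive forms of
(A)) = VARIANT, never a second node (P2); SIEGEL-INERT. [difficulty: open-problem] (why it might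
fail: Kernel-implied by FL, GHL and Parity, so false only with them; live risk = (A) is TRUE ((A)
holds for 5x/(7 log x log log x) ≤ y ≤ x, Dusart; ChahalEtAl2026 Thm 1.1), which would refute
DHL[2263,2263], FL, GHL, BH: the typed kill path.) [HardyLittlewoodPN3, Richards1974,
HensleyRichards1974, CrandallPomerance1999, ChahalEtAl2026, arXiv:2605.19165, Polymath8b2014,
Literature.Barriers.Parity.HensleyRichards1974, Literature.Barriers.Parity.MaynardFunctionalCeiling]
#3 ConvexityLift (crux) — ConvexityFails → FixedLower (the record leaf stmt-Parity-26863, text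
verbatim): from «one nonconvex prime constellation» to the one-sided Hardy–Littlewood lower bound
archFactor·singularProduct − vonMangoldtSum ≤ εN^d for every fixed non-degenerate system — DECLARED
RESIDUAL (all parity content of FL; PARITY-LOADED, TERMINAL, zero credit; never staffed — NO prover
time, P1); trivial branch convexityLift_of_not, contraction contracts (when ConvexityFails lands the
route contracts onto the record). [deps: ConvexityFails] [difficulty: open-problem] (why it might
fail: Kernel-implied by FL (trivially); as an implication it must manufacture twin primes and every
prime k-tuple with the HL constant from ONE nonconvex constellation — head-on PrimePairParity /
SelbergParity / FordMaynard; no mechanism in print.) [GreenTao2010, HardyLittlewood1923,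
Richards1974, FordMaynard2024PrimeSieves, Literature.Barriers.Parity.PrimePairParity,
Literature.Barriers.Parity.SelbergParityBarrier]
#4 UniformLowerGivenFixed (crux) — the record's item stmt-Parity-26864 verbatim (Q → FixedLower →
the uniform lower half of GHL); shared by signature, filing fields = the record's. [difficulty:
open-problem] (why it might fail: It contains binary Goldbach with the Hardy–Littlewood main term
for every large even N, given Q and the tuples: no method controls an individual shift h ≍ N;
almost-all-h results (MRT 2019, window N^(8/33)) are the ceiling.) [GreenTao2010,
HardyLittlewood1923, MatomakiRadziwillTao2019, MatomakiMerikoski2023,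
Literature.Barriers.Parity.CircleMethodBinary]
#5 UniformUpperGivenFixed (crux) — the record's item stmt-Parity-26853 verbatim (Q → FixedUpper →
the uniform upper half of GHL); shared by signature, filing fields = the record's. [difficulty:
open-problem] (why it might fail: It is the uniform-in-shift (binary Goldbach-type) upper bound with
factor 1+ε given Q and all tuples: pointwise-in-h control beyond windows N^(8/33) (MRT 2019) is
open; the circle method misses binary minor arcs by log x.) [GreenTao2010, MatomakiRadziwillTao2019,
MatomakiMerikoski2023, Literature.Barriers.Parity.TrueComplexityBinary,
Literature.Barriers.Parity.CircleMethodBinary]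
#6 BoundedSiegelZeroQuality (crux) — the record's Siegel crux stmt-Parity-25148 verbatim
(exceptional zeros have bounded quality η); shared by signature, filing fields = the record's.
[difficulty: open-problem] (why it might fail: it is the Landau–Siegel problem: no unconditional
bound on η is known (Siegel's theorem is ineffective); a genuine open problem, not a lemma.)
[HeathBrown1983PrimeTwins, MatomakiMerikoski2023, TaoTeravainen2021]
#7 FixedUpper (crux) — the record's item stmt-Parity-26852 verbatim (upper half of GT Conj. 1.2 for
every fixed non-degenerate system); shared by signature, filing fields = the record's. [difficulty:
open-problem] (why it might fail: As a target it contains the upper prime k-tuples bound with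
constant 1+ε for every fixed tuple: Type-I sieves stop at factor 2 (Selberg parity,
LinearSieveOptimality); record 3.2996 for twins; open even under GRH.) [GreenTao2010,
HardyLittlewood1923, Selberg1949, Literature.Barriers.Parity.SelbergParityBarrier,
Literature.Barriers.Parity.LinearSieveOptimality]

TWO-LAYER PLAN. None at open. ConvexityFails is a literal-free Σ₁-notch and is never re-dialled
(other lengths y, other excesses m, the lim-sup form ρ(y) ≤ π(y) of (A)
versus the subadditive form: VARIANT, P2). The rungs ABOVE it on the bridge (ClusterAt 20000 2263 ⟸
ρ = ρ* ⟸ DHL ∀k ⟸ Dickson ⟸ FL, all kernel-necessary)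
are banked, not filed; if ever, «ClusterTwentyThousand» (ρ(20000) ≥ 2263) and «ClusterTwentyThousand
→ ConvexityFails» (provable now) are the BC3 skeleton's
stubs, not items. ConvexityLift is a residual and is never split. If ConvexityFails lands,
ConvexityLift ≡ FL (costume) and the route is superseded by
the record (declared).

KILL CRITERIA. A PROOF of the convexity conjecture (A), by any method, refutes ConvexityFails and
with it FL, GHL, BH and Parity (kernel not_fixedLower_of_secondHL /
not_ghl_of_secondHL / not_parity_of_secondHL; tree not_weakDHL_of_secondHardyLittlewood): route,
sub-problem and summit close refuted together — (A) IS a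
theorem in the wedge 5x/(7 log x log log x) ≤ y ≤ x (Dusart) and in the range of ChahalEtAl2026 Thm
1.1, which maps where the Σ₁ witness cannot be (kill
instrument, P5). A nonconvex constellation FOUND among primes (an instance of Engelsma's (459, 3242)
pattern or any π(y)+1 primes in a window of length y)
closes ConvexityFails by `decide`/certificate and collapses the route onto the record (ConvexityLift
becomes FL: superseded, declared) — «no actual instance
has yet been discovered», first expected near x ≈ k^k (Richards), not a search target. A tribunal
finding that ConvexityFails is a RUNG of the DHL programme
rather than a piece (T13 drift) retires the route to the census; the kernel necessity theorems
survive as support landings on 26863.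

NOT DECOMPOSED YET. ConvexityFails is not decomposed into «ρ(20000) ≥ 2263» ∧ «that cluster ⟹ ¬(A)»
at open (the second is bookkeeping over π(20000) = 2262; the first is the
whole difficulty and sits at prime-tuple strength m/k → 1). The packing side (ρ*(y) > π(y) for
smaller y: Engelsma–Holt (458, 3240), (459, 3242); our own
certified crossings) is an INSTRUMENT in the currency, zero credit, filed — if at all — as
kit/census items, never as route items. No statement asserting
(A) in any range is filed as an item (kill-side instruments are Literature facts). No (y, m) cell
with m ≤ π(y) is filed (those are FL's own transferred
cells / bounded-gap records).

CHEAPEST FALSIFIER. (i) Theorem test (T8): is ¬(A) already a theorem? No — «no such counterexamples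
are known» (ChahalEtAl2026 §1), «no actual instance of a nonconvex
constellation among primes has yet been discovered» (arXiv:2605.19165 §1); every tree route to ¬(A)
takes DHL[2263,2263] (not_secondHardyLittlewood_of_weakDHL,
hensleyRichards_incompatibility, HensleyRichards1974.not_secondHardyLittlewood); BC4 `exact?` with
the Hensley–Richards module in scope FAILS (bc4_dedup_full).
(ii) Is (A) already a theorem (which would kill the summit)? No — only in wedges (Dusart;
ChahalEtAl2026 Thm 1.1; Montgomery–Vaughan π(x+y) ≤ π(x) + 2π(y)).
(iii) Vacuity: ConvexityFails is a plain negation of a ∀∀-statement over ℕ with decidable atoms —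
neither trivially true (no witness below any searched
bound; π is subadditive on all computed ranges) nor trivially false; ConvexityLift is not vacuous
(its hypothesis is consistent, implied by GHL).
(iv) C → S probes: ConvexityFails ⇏ GHL / FL cheaply, ConvexityLift ⇏ ConvexityFails / FL cheaply
(BC2 batteries fail 7/7; BC7 P5 fails).

NUMBERS. π(20000) = 2262 < 2263 ≤ ρ*(20000) (Richards 1974 / Stenberg; tree decide); smallest
nonconvex admissible constellations (J, |s|) = (458, 3240), (459, 3242)
(Engelsma; arXiv:2605.19165), i.e. ρ*(3243) ≥ 459 > π(3243) = 458 would lower the certified crossing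
20000 → 3243 (instrument); ρ*(y) − π(y) ≍ y/log² y → ∞
(Hensley–Richards Thm 4.1). Prime side: ρ(247) ≥ 2 (Polymath8b Thm 1.4(i): p_(n+1) − p_n ≤ 246
i.o.); ρ(y) ≥ m for y ≥ C·e^(3.815 m) (Polymath8b Thm
3.2(vi) / Baker–Irving), i.e. ρ(y) ≳ (1/3.815) log y against the target π(y)+1 ≍ y/log y. Sieve
ceiling at the crossing: MaynardCriterion θ k m needs
k > exp(2m/θ − 1); with m = 2262, θ ≤ 1 that is k > e^4523 ≫ 20000 (kernel exp_4523_gt,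
crossing_beyond_exp_ceiling). First prime-side witness expected near
x ≈ k^k with k = 2263 (Richards' remark).

DEFINITION REQUESTS. None: every item is stated over existing declarations (Nat.primeCounting;
Literature.NumberTheory.Sieve.{AffLinForm, IsNondegenerateSystem, affLinSize,
realBox, vonMangoldtSum, archFactor, singularProduct}; Literature.Barriers.Parity.IsSiegelZero;
DirichletCharacter). ClusterAt y m («∃ᶠ x, m ≤ π(x+y) − π x»)
stays INLINE in the hand file (P3), no Defs file.

Novelty: Searches (2026-08-30, g8 + g9): rg 'Hensley|SecondHardy|rhoStar|convexity|cluster' over HOME TREE.md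
v5.0–v5.3, CRITIC-LEDGER.md, STATUS.md and lean/Summits/Parity/*/Theses/*.lean (hits: the
barrier-catalogue listing of (A) as an incompatible piece; hardness docstrings in
LeeYangFibresPrimeCellsRelativeDickson and the ArtinGenericSplit necessity file; no Theses ITEM of
shape ¬(A)); ledger negatives --problem Parity (12 rows: (A)-with-tuples is the refuted shape, ¬(A)
is not listed); ledger idea list (closed convexity cards only as consequences); lit search --hybrid
"second Hardy-Littlewood conjecture incompatible prime k-tuples" (corpus:
book:crandall1999-prime-numbers-computational-perspective p.62 Conj. 1.2.3; paper:arxiv-1407.4897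
p.42 Engelsma's narrow-tuple data; paper:arxiv-2605.19165 Holt 2026 pp.1–2); lit galaxy search
"second Hardy-Littlewood conjecture|Hensley and Richards|nonconvex constellation" --star all (12
rows: galaxy:panama:262611480346637 Broughan «Bounded gaps between primes»;
galaxy:pdf:-4633691470138107480 Erdős 1982 «Some of my favourite problems»; no further primary
source); lean search 'SecondHardyLittlewoodConjecture' (tree: HensleyRichards.lean,
SchinzelHypothesisH consequences only); BC4 exact? ×3 FAIL.
Nearest prior art found: HensleyRichards1974 / Richards1974 (the incompatibility and the certificate
x₀ = 20000), CrandallPomerance1999 Conj. 1.2.3 («the current thinking is that the convexity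
conjecture is false»), Engelsma's and Holt's nonconvex a  [refs: 2605.19165, book:crandall1999-prime-numbers-computational-perspective, paper:arxiv-1407.4897, paper:arxiv-2605.19165, HensleyRichards1974, Richards1974, CrandallPomerance1999, ChahalEtAl2026]

Barriers (technique_class: decomposition, prime-k-tuples, tuple-packing): - technique_class: decomposition, prime-k-tuples, tuple-packing
- Literature.Barriers.Parity.HensleyRichards1974: the catalogued barrier kills pieces asserting (A)
together with prime tuples; this route files ¬(A) — the barrier theorem
(hensleyRichards_incompatibility, not_weakDHL_of_secondHardyLittlewood) is the route's NECESSITY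
ENGINE, not an obstruction; evasion = we are on the side the barrier predicts.
- Literature.Barriers.Parity.MaynardFunctionalCeiling: ConvexityFails is INSIDE the ambition of the
multidimensional-sieve class (DHL[k, m+1]) but OUTSIDE its reach by a kernel inequality —
MaynardCriterion θ k 2262 needs k > exp(2·2262/θ − 1) ≥ e^4523 while the crossing needs k ≤ 20000,
for EVERY 0 < θ ≤ 1 (BV and EH alike; kernel crossing_beyond_exp_ceiling); for larger y the ratio
(π(y)+1)/ρ*(y) → 1 stays outside m ≲ (θ/2) log k. requires-beating-barrier: YES, honestly — hence
IDEA-NEEDED, no prover time, credit only in the currency (critic row 75); residual declared: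
ConvexityLift.
- Literature.Barriers.Parity.SelbergParityBarrier / Literature.Barriers.Parity.PrimePairParity /
Literature.Barriers.Parity.FordMaynardMinimalTypeII: these bound what Type-I/II information yields
for prime PAIRS / tuples; ConvexityFails needs ρ(y) > π(y) for one y — a tuple-density statement of
the same parity-blocked kind (already m ≥ 3 of k needs more than DHL[k,2]); INSIDE, no evasion
claimed (IDEA-NEEDED); ConvexityLift inside head-on (residual, declared).
- Literature.Barriers.Parity.L

History (route lifecycle, newest last):
- 2026-09-04T15:41:53Z · DORMANT — reconciler: no traction for 5 d (last activity statement-checked at 2026-08-30T14:19:48Z); parked, not closed — `ledger route dormant route-Parity-ConvexityCros (operator:999:3269130)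

sub-problem: GeneralizedHardyLittlewood · status: dormant · opened planner-decomp-parity-lens-5-g9-0 2026-08-30T10:35:24Z · rev 0 · ledger route-Parity-ConvexityCrossing
GENERATED by the gate from the ledger (D-0016/17). Provers cite these decls: `theorem foo : Summit.Parity.GeneralizedHardyLittlewood.Theses.ConvexityCrossing.<Decl> := …` in Summits/Parity/GeneralizedHardyLittlewood/Theorems/<Name>.lean.
-/

namespace Summit.Parity.GeneralizedHardyLittlewood.Theses.ConvexityCrossing

open scoped BigOperators Topology Manifold Classical MeasureTheory ProbabilityTheory Matrix InnerProductSpace ComplexConjugate ContinuousMap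
open Filter Set Function TopologicalSpace MeasureTheory

attribute [summit_statement] _root_.GeneralizedHardyLittlewood

/-- item stmt-Parity-32197 · crux · rank 2 · open · by planner
why it might fail: Kernel-implied by FL, GHL and Parity, so false only with them; live risk = (A) is TRUE ((A) holds for 5x/(7 log x log log x) ≤ y ≤ x, Dusart; ChahalEtAl2026 Thm 1.1), which would refute DHL[2263,2263], FL, GHL, BH: the typed kill path.
sources: HardyLittlewoodPN3, Richards1974, HensleyRichards1974, CrandallPomerance1999, ChahalEtAl2026, arXiv:2605.19165
[crux] the second Hardy–Littlewood (convexity) conjecture (A) «π(x+y) ≤ π(x) + π(y) for all integers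
x, y ≥ 2» (HardyLittlewoodPN3 §5.61 p. 54; Richards1974 (A) p. 421; CrandallPomerance1999 Conj.
1.2.3) FAILS: ∃ x, y ≥ 2 with π(x) + π(y) < π(x+y) (kernel convexityFails_iff) — text `Iff.rfl` with
¬ Literature.Barriers.Parity.SecondHardyLittlewoodConjecture. NECESSARY ×3 hypothesis-free (kernel
convexityFails_of_fixedLower = landed GhostBoundaryCarvingTwoOfThree.weakDHL_of_fixedLower ∘ tree
hensleyRichards_incompatibility through the decide-certificate ρ*(20000) ≥ 2263 > π(20000) = 2262;
convexityFails_of_ghl; convexityFails_of_parity; nec_input DHL[2263,2263] = tree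
not_secondHardyLittlewood_of_weakDHL) and STRICTLY WEAKER (one Σ₁ instance, no asymptotic, no
constant, no pattern). TAGS (critic row 75): IDEA-NEEDED Σ₁-NOTCH, AXIS REGISTRATION, distance
credit 0; credit ONLY in the ρ(y) − π(y) currency and only for certified rungs (packing side: ρ*
tables, Engelsma–Holt (459, 3242) by decide = zero-summit-credit instruments; prime side: ClusterAt
y m records with m ≤ π(y), floor ρ(247) ≥ 2 CLAIMED (add-on farm-stale, P4), zero credit until m =
π(y)+1); NO PROVER TIME (P1) — hands onl -/
@[route_item "route-Parity-ConvexityCrossing"]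
def ConvexityFails : Prop :=
  ¬ (∀ x y : ℕ, 2 ≤ x → 2 ≤ y → Nat.primeCounting (x + y) ≤ Nat.primeCounting x + Nat.primeCounting y)

/-- item stmt-Parity-32198 · crux · rank 3 · open · by planner
why it might fail: Kernel-implied by FL (trivially); as an implication it must manufacture twin primes and every prime k-tuple with the HL constant from ONE nonconvex constellation — head-on PrimePairParity / SelbergParity / FordMaynard; no mechanism in print.
sources: GreenTao2010, HardyLittlewood1923, Richards1974, FordMaynard2024PrimeSieves, Literature.Barriers.Parity.PrimePairParity, Literature.Barriers.Parity.SelbergParityBarrier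
[crux] ConvexityFails → FixedLower (the record leaf stmt-Parity-26863, text verbatim): from «one
nonconvex prime constellation» to the one-sided Hardy–Littlewood lower bound
archFactor·singularProduct − vonMangoldtSum ≤ εN^d for every fixed non-degenerate system — DECLARED
RESIDUAL (all parity content of FL; PARITY-LOADED, TERMINAL, zero credit; never staffed — NO prover
time, P1); trivial branch convexityLift_of_not, contraction contracts (when ConvexityFails lands the
route contracts onto the record). [deps: ConvexityFails] [difficulty: open-problem] -/
@[route_item "route-Parity-ConvexityCrossing"]
def ConvexityLift : Prop :=
  (¬ (∀ x y : ℕ, 2 ≤ x → 2 ≤ y → Nat.primeCounting (x + y) ≤ Nat.primeCounting x + Nat.primeCounting y)) → (∀ (d t : ℕ), 1 ≤ d → 1 ≤ t → ∀ Ψ : Fin t → Literature.NumberTheory.Sieve.AffLinForm d, Literature.NumberTheory.Sieve.IsNondegenerateSystem Ψ → ∀ ε : ℝ, 0 < ε → ∃ N₀ : ℕ, ∀ N : ℕ, N₀ ≤ N → ∀ K : Set (Fin d → ℝ), Convex ℝ K → K ⊆ Literature.NumberTheory.Sieve.realBox d N → Literature.NumberTheory.Sieve.archFactor Ψ K * Literature.NumberTheory.Sieve.singularProduct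 Ψ - Literature.NumberTheory.Sieve.vonMangoldtSum Ψ K N ≤ ε * (N : ℝ) ^ d)

/-- item stmt-Parity-26864 · crux · rank 4 · open · by planner
why it might fail: It contains binary Goldbach with the Hardy–Littlewood main term for every large even N, given Q and the tuples: no method controls an individual shift h ≍ N; almost-all-h results (MRT 2019, window N^(8/33)) are the ceiling.
sources: GreenTao2010, HardyLittlewood1923, MatomakiRadziwillTao2019, MatomakiMerikoski2023, Literature.Barriers.Parity.CircleMethodBinary
[crux · DECLARED-RESIDUAL; node TupleUniformitySplit (lens-5 g3): shift-uniformity of the lower half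
GIVEN bounded Siegel quality and the fixed-pattern lower half] Q → FixedLower → (uniform lower half
of GHL). Exactly the binary content of LQ — binary Goldbach for all large even N with the HL main
term, and all moving-shift lower bounds — with the tuples split off: kernel
lowerGivenBoundedSiegel_iff : LQ ↔ (Q → FixedLower) ∧ this; WEAKER than LQ (world ¬(Q →
FixedLower)); FixedLower hypothesis load-bearing (T6). INSTRUMENTABLE: kernel
windowLower_of_fixedLower gives all shift windows ≫ εN from FixedLower_{d+1}; this item is
WINDOW(δN) → POINT; notch ladder = rungs (T11). -/
@[route_item "route-Parity-ConvexityCrossing"]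
def UniformLowerGivenFixed : Prop :=
  (∃ η₀ : ℝ, ∃ q₀ : ℕ, ∀ (q : ℕ) [NeZero q] (χ : DirichletCharacter ℂ q) (η : ℝ), q₀ ≤ q → Literature.Barriers.Parity.IsSiegelZero χ η → η < η₀) → (∀ (d t : ℕ), 1 ≤ d → 1 ≤ t → ∀ Ψ : Fin t → Literature.NumberTheory.Sieve.AffLinForm d, Literature.NumberTheory.Sieve.IsNondegenerateSystem Ψ → ∀ ε : ℝ, 0 < ε → ∃ N₀ : ℕ, ∀ N : ℕ, N₀ ≤ N → ∀ K : Set (Fin d → ℝ), Convex ℝ K → K ⊆ Literature.NumberTheory.Sieve.realBox d N → Literature.NumberTheory.Sieve.archFactor Ψ K * Literature.NumberTheory.Sieve.singularProduct Ψ - Literature.NumberTheory.Sieve.vonMangoldtSum Ψ K N ≤ ε * (N : ℝ) ^ d) → ∀ (d t L : ℕ), 1 ≤ d → 1 ≤ t → ∀ ε : ℝ, 0 < ε → ∃ N₀ : ℕ, ∀ N : ℕ, N₀ ≤ N → ∀ Ψ : Fin t → Literature.NumberTheory.Sieve.AffLinForm d, Literature.NumberTheory.Sieve.IsNondegenerateSystem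 Ψ → Literature.NumberTheory.Sieve.affLinSize Ψ N ≤ L → ∀ K : Set (Fin d → ℝ), Convex ℝ K → K ⊆ Literature.NumberTheory.Sieve.realBox d N → Literature.NumberTheory.Sieve.archFactor Ψ K * Literature.NumberTheory.Sieve.singularProduct Ψ - Literature.NumberTheory.Sieve.vonMangoldtSum Ψ K N ≤ ε * (N : ℝ) ^ d

/-- item stmt-Parity-26853 · crux · rank 5 · open · by planner
why it might fail: It is the uniform-in-shift (binary Goldbach-type) upper bound with factor 1+ε given Q and all tuples: pointwise-in-h control beyond windows N^(8/33) (MRT 2019) is open; the circle method misses binary minor arcs by log x.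
sources: GreenTao2010, MatomakiRadziwillTao2019, MatomakiMerikoski2023, Literature.Barriers.Parity.TrueComplexityBinary, Literature.Barriers.Parity.CircleMethodBinary
[crux · DECLARED-RESIDUAL; node TupleUniformitySplit (lens-5 g3): shift-uniformity of the upper half
GIVEN bounded Siegel quality and the fixed-pattern upper half] Q → FixedUpper → (uniform upper half
of GHL: one N₀(d,t,L,ε) for all Ψ with ‖Ψ‖_N ≤ L). Exactly the binary / moving-target content of UQ
(Goldbach-type systems (n, N−n), shifts h ≍ N) with the tuple content split off: kernel
upperGivenBoundedSiegel_iff : UQ ↔ (Q → FixedUpper) ∧ this, so WEAKER than UQ (separating world ¬(Q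
→ FixedUpper)) and the FixedUpper hypothesis is load-bearing (T6). Transpose of the PairsToGHL cut
(9389: pairs-uniform base, tuples residual). INSTRUMENTABLE: kernel windowUpper_of_fixedUpper —
FixedUpper in dimension d+1 already gives every shift-WINDOW average of length ≫ εN; this item is
WINDOW(δN) → POINT; notches N^{8/33} (MRT) → N^{7/30} (ShiftTauberian) → polylog are rungs (T11),
not filed. -/
@[route_item "route-Parity-ConvexityCrossing"]
def UniformUpperGivenFixed : Prop :=
  (∃ η₀ : ℝ, ∃ q₀ : ℕ, ∀ (q : ℕ) [NeZero q] (χ : DirichletCharacter ℂ q) (η : ℝ), q₀ ≤ q → Literature.Barriers.Parity.IsSiegelZero χ η → η < η₀) → (∀ (d t : ℕ), 1 ≤ d → 1 ≤ t → ∀ Ψ : Fin t → Literature.NumberTheory.Sieve.AffLinForm d, Literature.NumberTheory.Sieve.IsNondegenerateSystem Ψ → ∀ ε : ℝ, 0 < ε → ∃ N₀ : ℕ, ∀ N : ℕ, N₀ ≤ N → ∀ K : Set (Fin d → ℝ), Convex ℝ K → K ⊆ Literature.NumberTheory.Sieve.realBox d N → Literature.NumberTheory.Sieve.vonMangoldtSum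 Ψ K N - Literature.NumberTheory.Sieve.archFactor Ψ K * Literature.NumberTheory.Sieve.singularProduct Ψ ≤ ε * (N : ℝ) ^ d) → ∀ (d t L : ℕ), 1 ≤ d → 1 ≤ t → ∀ ε : ℝ, 0 < ε → ∃ N₀ : ℕ, ∀ N : ℕ, N₀ ≤ N → ∀ Ψ : Fin t → Literature.NumberTheory.Sieve.AffLinForm d, Literature.NumberTheory.Sieve.IsNondegenerateSystem Ψ → Literature.NumberTheory.Sieve.affLinSize Ψ N ≤ L → ∀ K : Set (Fin d → ℝ), Convex ℝ K → K ⊆ Literature.NumberTheory.Sieve.realBox d N → Literature.NumberTheory.Sieve.vonMangoldtSum Ψ K N - Literature.NumberTheory.Sieve.archFactor Ψ K * Literature.NumberTheory.Sieve.singularProduct Ψ ≤ ε * (N : ℝ) ^ d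

/-- item stmt-Parity-25148 · crux · rank 6 · open · by planner
why it might fail: it is the Landau–Siegel problem: no unconditional bound on η is known (Siegel's theorem is ineffective); a genuine open problem, not a lemma.
sources: HeathBrown1983PrimeTwins, MatomakiMerikoski2023, TaoTeravainen2021
[crux] Siegel zeros of primitive quadratic characters have bounded quality at all large conductors:
∃ η₀ q₀, every Siegel zero (IsSiegelZero χ η) of conductor q ≥ q₀ has η < η₀ — literally
¬UnboundedSiegelZeros (Landau–Siegel in the form the MM bridge needs). [difficulty: open-problem] ‖
TAG [crit-1 CLEARED 2026-08-30T01:46:27Z, HOME/STATUS.md l.26]: WEAKER (kernel mod MM2023 print; Q ⟹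
GHL unknown); leaf IDEA-NEEDED (Landau–Siegel) + ATTACKABLE-rung (Zhang2022 skeleton routes
PrimeLevelFamEdge/ZDegreeToeplitzBand; lens-2 T_ω ladder) + INSTRUMENTABLE (finite conductor tables,
not a rung). BC3 birth skeleton: stub_weakGoldbach (WeakHLGoldbachConj ½, open) → stub_exclusion
(MM2023 Cor 1.2 Goldbach detector + |L'| ≪ log²q, provable-now) → Q. Census
HOME/census/COSTUME-CENSUS-v1.md sha256
4afbbbc68c038369818dcc2bcc5990569ac50a4757d8938468c0838377ddd628 row WK8. -/
@[route_item "route-Parity-ConvexityCrossing"]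
def BoundedSiegelZeroQuality : Prop :=
  ∃ η₀ : ℝ, ∃ q₀ : ℕ, ∀ (q : ℕ) [NeZero q] (χ : DirichletCharacter ℂ q) (η : ℝ), q₀ ≤ q → Literature.Barriers.Parity.IsSiegelZero χ η → η < η₀

/-- item stmt-Parity-26852 · crux · rank 7 · open · by planner
why it might fail: As a target it contains the upper prime k-tuples bound with constant 1+ε for every fixed tuple: Type-I sieves stop at factor 2 (Selberg parity, LinearSieveOptimality); record 3.2996 for twins; open even under GRH.
sources: GreenTao2010, HardyLittlewood1923, Selberg1949, Literature.Barriers.Parity.SelbergParityBarrier, Literature.Barriers.Parity.LinearSieveOptimality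
[crux; node TupleUniformitySplit (lens-5 g3, crit-1 CLEARED 2026-08-30T03:41:11Z STATUS l.116),
quantifier-order cut of UQ: the FIXED-PATTERN upper half] For every FIXED non-degenerate
affine-linear system Ψ (all d, t; quantifier order ∀Ψ ∃N₀, no size bound) and ε > 0, eventually in N
and uniformly in convex K ⊆ [−N,N]^d: Σ_{n∈K} ∏Λ(ψ_i(n)) − β_∞(Ψ,K)·∏β_p(Ψ) ≤ εN^d. OPEN CONTENT =
INFINITE complexity only (two affinely dependent forms: the k-tuple translates n+h_1,…,n+h_k and
their fibrations; d = 1 translate face = upper prime k-tuples in Λ-form, all k); finite-complexity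
systems are the Green–Tao–Ziegler THEOREM — the AP face is not progress (critic N2). WEAKER than UQ
and than the uniform upper half (kernel: necessity fixedUpper_of_ghl; Goldbach-vacuity
fixed_holds_goldbachPair — (n, c−n) satisfies it trivially, so no binary content; Siegel-INERT:
fixed-shift HL holds near exceptional scales, MatomakiMerikoski2023_fixedShift / Heath-Brown 1983 /
Tao–Teräväinen, while USZ refutes the uniform half) — hence typed BARE (record T1 logic). Leaf
BARRIER head-on (target constant 1; Type-I sieve ceiling 2 even under EH: SelbergParity,
LinearSieveOptimality); FU is ⊠-closed, so a constan -/
@[route_item "route-Parity-ConvexityCrossing"]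
def FixedUpper : Prop :=
  ∀ (d t : ℕ), 1 ≤ d → 1 ≤ t → ∀ Ψ : Fin t → Literature.NumberTheory.Sieve.AffLinForm d, Literature.NumberTheory.Sieve.IsNondegenerateSystem Ψ → ∀ ε : ℝ, 0 < ε → ∃ N₀ : ℕ, ∀ N : ℕ, N₀ ≤ N → ∀ K : Set (Fin d → ℝ), Convex ℝ K → K ⊆ Literature.NumberTheory.Sieve.realBox d N → Literature.NumberTheory.Sieve.vonMangoldtSum Ψ K N - Literature.NumberTheory.Sieve.archFactor Ψ K * Literature.NumberTheory.Sieve.singularProduct Ψ ≤ ε * (N : ℝ) ^ d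

/-- item stmt-Parity-32199 · assembly · rank 1 · closed · proved by Summit.Parity.GeneralizedHardyLittlewood.Theses.ConvexityCrossing.assembly_proof (prover) · by planner
sources: GreenTao2010, Richards1974
[assembly] BoundedSiegelZeroQuality → FixedUpper → UniformUpperGivenFixed → ConvexityFails →
ConvexityLift → UniformLowerGivenFixed → GeneralizedHardyLittlewood -/
@[route_item "route-Parity-ConvexityCrossing"]
def Assembly : Prop :=
  BoundedSiegelZeroQuality → FixedUpper → UniformUpperGivenFixed → ConvexityFails → ConvexityLift → UniformLowerGivenFixed → GeneralizedHardyLittlewood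

-- `Assembly` holds: proved by `Summit.Parity.GeneralizedHardyLittlewood.Theses.ConvexityCrossing.assembly_proof` (its module imports this route file, so no `_holds` link can be stated here).

/-! D-0027 §2.1 — DECIDING THEOREM (planner-authored via `route open/edit --closes-file`; by planner-decomp-parity-lens-5-g9-0 2026-08-30T10:35:24Z):
its hypotheses are this route's items and its conclusion the sub-problem Statement (glue_lint), and it elaborates with this file. -/

@[closes "route-Parity-ConvexityCrossing"] theorem closes (hQ : BoundedSiegelZeroQuality) (hFU : FixedUpper) (hUU : UniformUpperGivenFixed)
    (hC : ConvexityFails) (hL : ConvexityLift) (hUL : UniformLowerGivenFixed) : GeneralizedHardyLittlewood := by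
  intro d t L hd ht ε hε
  obtain ⟨N₁, h₁⟩ := hUU hQ hFU d t L hd ht ε hε
  obtain ⟨N₂, h₂⟩ := hUL hQ (hL hC) d t L hd ht ε hε
  refine ⟨max N₁ N₂, fun N hN Ψ hΨ hΨL K hK hKN => abs_sub_le_iff.mpr ⟨?_, ?_⟩⟩
  · exact h₁ N (le_trans (le_max_left _ _) hN) Ψ hΨ hΨL K hK hKN
  · exact h₂ N (le_trans (le_max_right _ _) hN) Ψ hΨ hΨL K hK hKN

end Summit.Parity.GeneralizedHardyLittlewood.Theses.ConvexityCrossing
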